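import Literature.AlgebraicGeometry.Resolution.WeightedCentreLevelProjection
import Literature.AlgebraicGeometry.Resolution.WeightedCentreEigenLiftLevels
import Literature.AlgebraicGeometry.Resolution.WeightedCentreEigenProjection

/-!
# The EIGEN-LIFT LEMMA of the toy model (engine 1's `W(f)` toy model, target T101 — an instrument, NOT a resolution theorem)

Toy-model INSTANCE of RE-DERIVATION-eng1-g43 §3.2 (CARVER-NOTES-eng1-g43 §2 T101), assembled from the abstract layer
(`WeightedCentreEigenProjection` = STEP 1, `WeightedCentreEigenCosetLift` / `WeightedCentreEigenLiftLevels` = STEP 2) and the toy-specific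
bookkeeping (F3)/(F4)/(F6) of `WeightedCentreLevelProjection`, on `S = k[ε][σ] = (MvPolynomial ι k)[X]`, `char k = p`:

* `castUnit p : 𝔽_pˣ → kˣ` and the torus `s_μ := scaleConj (castUnit p μ)`; for a `Q = 𝔽_pˣ`-STABLE subgroup `H ≤ Aut S` the restriction
  `sConj H hQ μ : H →* H`;
* (F4)+(F5) ⇒ the hypothesis `hs` of `EigenLiftLevels.lift_levels`: `s_μ n · (n^N)⁻¹ ∈ H ∩ 𝔄_{m+1}` for `n ∈ H ∩ 𝔄_m`, `N ≡ μ^m (mod p)`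
  (`sConj_mul_inv_pow_mem`);
* STEP 1 (`exists_mem_levelIn_bottom_eq`): `A ∈ H` is pushed into `H ∩ 𝔄_r` keeping the bottom character `c`, by the character-projection word
  `Y = ∏_μ (s_μ A)^{c(μ)}` applied level by level (`EigenProjection.character_projection` with `π := π_m` kills the level, with `π := c` keeps `c`);
* STEP 2 + conclusion (`eigen_lift`): for `H ≤ 𝔄_1` of `k[σ]`-automorphisms, `Q`-stable, moving the bottom slots `z ∈ Z` by pure `σ^r`-terms,
  `2 ≤ r ≤ p − 1`, `n₀ ≡ μ₀^r (mod p)` and NON-RESONANT levels `r + 1 ≤ m < b` (`μ₀^m ≠ μ₀^r`; for a generator `μ₀` this is `b ≤ r + p − 1`,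
  `nonresonant_of_orderOf`): every `A ∈ H` has `A' ∈ H ∩ 𝔄_r` with `c(A') = c(A)` and `s_{μ₀} A' = A'^{n₀} · h`, `h ∈ H ∩ 𝔄_b`
  — `b = p + 1` for `r = 2`, `b = p + 2` for `r ≥ 3`, where `H ∩ 𝔄_{p+2} = {id}` for graded `H` with slot weights `< (p+2)·ρ`
  (`levelIn_eq_bot_of_graded`, `eigen_lift_exact`); `eigen_lift_orbit` / `eigen_lift_orbit_exact` are the engine's formulation with
  `H := ⟨s_μ X : μ ∈ Q⟩` (`μ₀` a generator of `𝔽_pˣ`, `exists_orderOf_eq`; graded `X` ⇒ `h = 1` for `b ≤ r + p − 1` with all slot weights `< b·ρ`);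
* CLIMB (CARVER-NOTES-eng1-g44 §2 T108, `eigen_climb` / `eigen_climb_exact` via `EigenLiftLevels.climb_levels`): an exact eigen-element `Φ ∈ H`
  and an approximate one `x` with `Φ⁻¹ x ∈ H ∩ 𝔄_a` have `Φ⁻¹ x ∈ H ∩ 𝔄_t` across non-resonant levels `a ≤ m < t` (`x = Φ` if `H ∩ 𝔄_t = {1}`);
* the DEEPEST LEVEL (T105 (n-2) / T107): `exists_deepest_level`, and there `s_μ x = x^N` EXACTLY for every `μ` (`sConj_eq_pow_of_levelIn_succ_eq_bot`), `π_r` is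
  injective (`eq_one_of_proj_eq_zero`) and some bottom character is non-zero once the off-bottom data vanish (`exists_bottom_ne_zero`).

Hypothesis-honest: the shape "(S) nothing is lighter than `Z`" enters as the explicit hypothesis `H ≤ pureSlot z r` (`z ∈ Z`), non-resonance as the
explicit `hres`; no hypothesis `(P)`, no statement about isotropies of a specific `g`.  Framing: instruments for engine 1's `W(f)` toy model (cell
`pub-rosobs`, carver lane gen 64; AI-written Lean, AI review weaker than expert review) — NOT statements about the invariant of
[AbramovichTemkinWlodarczyk2024], NOT resolution theorems.  Group theory and `𝔽_p`-arithmetic are textbook [Lang2002, Ch. I §§3, 6, Ch. V §5];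
formalisation and statements ours.
-/

namespace Literature.AlgebraicGeometry.Resolution.WeightedBlowup.EigenLift

open Polynomial OrderFiltration LevelProjection EigenLiftLevels

variable {k : Type*} [CommRing k] {ι : Type*} (p : ℕ) [Fact p.Prime] [CharP k p]

/-! ## The torus `Q = 𝔽_pˣ` -/

/-- `Q = 𝔽_pˣ → kˣ`, `μ ↦ μ · 1_k` (construction; `char k = p`). [cite: Lang2002, Ch. V §5] -/
def castUnit : (ZMod p)ˣ →* kˣ := Units.map (ZMod.castHom (dvd_refl p) k).toMonoidHom

/-- The scalar underlying `castUnit p μ` (plumbing). [cite: Lang2002, Ch. V §5] -/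
theorem val_castUnit (μ : (ZMod p)ˣ) : ((castUnit p μ : kˣ) : k) = ZMod.castHom (dvd_refl p) k (μ : ZMod p) := rfl

/-- `(μ · 1_k)^m = (μ^m) · 1_k` (plumbing). [cite: Lang2002, Ch. V §5] -/
theorem val_castUnit_pow (μ : (ZMod p)ˣ) (m : ℕ) :
    ((castUnit p μ : kˣ) : k) ^ m = ZMod.castHom (dvd_refl p) k ((μ : ZMod p) ^ m) := by
  rw [map_pow, val_castUnit]

/-- A natural number `N ≡ x (mod p)` is `x · 1_k` in `k` (plumbing). [cite: Lang2002, Ch. V §5] -/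
theorem natCast_eq_castHom {N : ℕ} {x : ZMod p} (hN : (N : ZMod p) = x) : (N : k) = ZMod.castHom (dvd_refl p) k x := by
  rw [← hN, map_natCast]

variable {p}

/-- The torus `s_μ = scaleConj (castUnit p μ)` restricted to a `Q`-stable subgroup `H ≤ Aut k[ε][σ]`, as an endomorphism `H →* H`
(construction; RE-DERIVATION-eng1-g43 §3.1 (F5) "`Q`-stable subgroup"). [cite: Lang2002, Ch. I §3] -/
noncomputable def sConj (H : Subgroup ((MvPolynomial ι k)[X] ≃+* (MvPolynomial ι k)[X]))
    (hQ : ∀ μ : (ZMod p)ˣ, ∀ A ∈ H, scaleConj (castUnit p μ) A ∈ H) (μ : (ZMod p)ˣ) : H →* H :=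
  ((scaleConj (castUnit p μ)).toMonoidHom.restrict H).codRestrict H fun x => hQ μ x x.2

/-- `sConj` is `s_μ` on the underlying automorphism (plumbing). [cite: Lang2002, Ch. I §3] -/
theorem coe_sConj (H : Subgroup ((MvPolynomial ι k)[X] ≃+* (MvPolynomial ι k)[X]))
    (hQ : ∀ μ : (ZMod p)ˣ, ∀ A ∈ H, scaleConj (castUnit p μ) A ∈ H) (μ : (ZMod p)ˣ) (x : H) :
    ((sConj H hQ μ x : H) : (MvPolynomial ι k)[X] ≃+* (MvPolynomial ι k)[X]) = scaleConj (castUnit p μ) (x : (MvPolynomial ι k)[X] ≃+* (MvPolynomial ι k)[X]) :=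
  rfl

/-! ## (F4) + (F5): the scalar action on the graded pieces (`hs` of `lift_levels`) -/

/-- **`s_μ` acts on `H ∩ 𝔄_m / H ∩ 𝔄_{m+1}` as the scalar `μ^m`**: for `n ∈ H ∩ 𝔄_m` and `N ≡ μ^m (mod p)`, both `s_μ n · (n^N)⁻¹` and
`(n^N)⁻¹ · s_μ n` lie in `H ∩ 𝔄_{m+1}` (RE-DERIVATION-eng1-g43 §3.1 (F4)/(F5): `π_m(s_μ n · n^{-N}) = (μ^m − N) π_m(n) = 0`; for `m = 0` trivially as
`H ≤ 𝔄_1`) — the hypothesis `hs` of `EigenLiftLevels.lift_levels` in the toy model (instrument, NOT a resolution theorem).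
[cite: Lang2002, Ch. I §§3, 6, Ch. V §5; AbramovichTemkinWlodarczyk2024, §5.1 (p. 1575)] -/
theorem sConj_mul_inv_pow_mem {H : Subgroup ((MvPolynomial ι k)[X] ≃+* (MvPolynomial ι k)[X])}
    (hH1 : H ≤ level (X : (MvPolynomial ι k)[X]) 1) (hHb : H ≤ baseFixing)
    (hQ : ∀ μ : (ZMod p)ˣ, ∀ A ∈ H, scaleConj (castUnit p μ) A ∈ H) (μ : (ZMod p)ˣ) (m : ℕ) {N : ℕ}
    (hN : (N : ZMod p) = (μ : ZMod p) ^ m) {n : H} (hn : n ∈ levelIn (X : (MvPolynomial ι k)[X]) H m) :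
    sConj H hQ μ n * (n ^ N)⁻¹ ∈ levelIn (X : (MvPolynomial ι k)[X]) H (m + 1) ∧
      (n ^ N)⁻¹ * sConj H hQ μ n ∈ levelIn (X : (MvPolynomial ι k)[X]) H (m + 1) := by
  rcases Nat.eq_zero_or_pos m with rfl | hm
  · exact ⟨hH1 (sConj H hQ μ n * (n ^ N)⁻¹).2, hH1 ((n ^ N)⁻¹ * sConj H hQ μ n).2⟩
  have hn' : (n : (MvPolynomial ι k)[X] ≃+* (MvPolynomial ι k)[X]) ∈ level (X : (MvPolynomial ι k)[X]) m := hn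
  have hsn : scaleConj (castUnit p μ) (n : (MvPolynomial ι k)[X] ≃+* (MvPolynomial ι k)[X]) ∈ level (X : (MvPolynomial ι k)[X]) m :=
    scaleConj_mem_level _ (hHb n.2) hn'
  have hpow : ((n : (MvPolynomial ι k)[X] ≃+* (MvPolynomial ι k)[X]) ^ N)⁻¹ ∈ level (X : (MvPolynomial ι k)[X]) m :=
    (level _ m).inv_mem ((level _ m).pow_mem hn' N)
  have hsnb : scaleConj (castUnit p μ) (n : (MvPolynomial ι k)[X] ≃+* (MvPolynomial ι k)[X]) ∈ baseFixing :=
    scaleConj_mem_baseFixing _ (hHb n.2)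
  have hpowb : ((n : (MvPolynomial ι k)[X] ≃+* (MvPolynomial ι k)[X]) ^ N)⁻¹ ∈ baseFixing :=
    baseFixing.inv_mem (baseFixing.pow_mem (hHb n.2) N)
  have hproj : ∀ i, proj m (scaleConj (castUnit p μ) (n : (MvPolynomial ι k)[X] ≃+* (MvPolynomial ι k)[X])) i +
      proj m (((n : (MvPolynomial ι k)[X] ≃+* (MvPolynomial ι k)[X]) ^ N)⁻¹) i = 0 := fun i => by
    rw [proj_scaleConj, proj_inv hm ((level _ m).pow_mem hn' N), proj_pow hm hn', nsmul_eq_mul,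
      ← map_natCast (MvPolynomial.C : k →+* MvPolynomial ι k) N, val_castUnit_pow, natCast_eq_castHom p hN, add_neg_cancel]
  constructor
  · rw [mem_levelIn, Subgroup.coe_mul, Subgroup.coe_inv, Subgroup.coe_pow, coe_sConj]
    exact mem_level_succ_of_proj_eq_zero (mul_mem hsn hpow) (mul_mem hsnb hpowb) fun i => by rw [proj_mul hm hsn hpow, hproj]
  · rw [mem_levelIn, Subgroup.coe_mul, Subgroup.coe_inv, Subgroup.coe_pow, coe_sConj]
    exact mem_level_succ_of_proj_eq_zero (mul_mem hpow hsn) (mul_mem hpowb hsnb) fun i => by rw [proj_mul hm hpow hsn, add_comm, hproj]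

/-! ## STEP 1: push into `H ∩ 𝔄_r` keeping the bottom character -/

/-- **STEP 1, one level** (RE-DERIVATION-eng1-g43 §3.2): for `B ∈ H ∩ 𝔄_m`, `1 ≤ m < r ≤ p − 1`, the character-projection word
`Y = ∏_μ (s_μ B)^{c(μ)}` lies in `H ∩ 𝔄_{m+1}` (`π_m(Y) = [m = r] π_m(B) = 0`, (F3)/(F4)) and has the same bottom character on every bottom slot
(`c(Y) = [r = r] c(B)`, (F6)) (instrument, NOT a resolution theorem). [cite: Lang2002, Ch. I §3, Ch. V §5; AbramovichTemkinWlodarczyk2024, §5.1 (p. 1575)] -/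
theorem exists_mem_levelIn_succ_bottom_eq {H : Subgroup ((MvPolynomial ι k)[X] ≃+* (MvPolynomial ι k)[X])}
    (hHb : H ≤ baseFixing) (hQ : ∀ μ : (ZMod p)ˣ, ∀ A ∈ H, scaleConj (castUnit p μ) A ∈ H) {Z : Set ι} {r : ℕ}
    (hHZ : ∀ z ∈ Z, H ≤ pureSlot z r) (hr : 2 ≤ r) (hrp : r ≤ p - 1) {m : ℕ} (hm1 : 1 ≤ m) (hmr : m < r) {B : H}
    (hB : B ∈ levelIn (X : (MvPolynomial ι k)[X]) H m) :
    ∃ B' : H, B' ∈ levelIn (X : (MvPolynomial ι k)[X]) H (m + 1) ∧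
      ∀ z ∈ Z, bottom r (B' : (MvPolynomial ι k)[X] ≃+* (MvPolynomial ι k)[X]) z =
        bottom r (B : (MvPolynomial ι k)[X] ≃+* (MvPolynomial ι k)[X]) z := by
  haveI : NeZero p := ⟨(Fact.out : p.Prime).ne_zero⟩
  let g : (ZMod p)ˣ → H := fun μ => sConj H hQ μ B
  have hg : ∀ μ, g μ ∈ levelIn (X : (MvPolynomial ι k)[X]) H m := fun μ => scaleConj_mem_level _ (hHb B.2) hB
  have hB' : (B : (MvPolynomial ι k)[X] ≃+* (MvPolynomial ι k)[X]) ∈ level (X : (MvPolynomial ι k)[X]) m := hB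
  -- the word lies in `H ∩ 𝔄_m`
  have hwN : EigenProjection.word p r g ∈ levelIn (X : (MvPolynomial ι k)[X]) H m := by
    unfold EigenProjection.word
    refine Subgroup.list_prod_mem _ fun x hx => ?_
    obtain ⟨μ, -, rfl⟩ := List.mem_map.mp hx
    exact Subgroup.pow_mem _ (hg μ) _
  refine ⟨EigenProjection.word p r g, ?_, fun z hz => ?_⟩
  · -- `π_m` kills the word: character projection with `π := π_m(·)_i`, valued in the `𝔽_p`-module `k[ε]`
    refine mem_level_succ_of_proj_eq_zero hwN (hHb (EigenProjection.word p r g).2) fun i => ?_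
    letI : Module (ZMod p) (MvPolynomial ι k) :=
      Module.compHom (MvPolynomial ι k) ((algebraMap k (MvPolynomial ι k)).comp (ZMod.castHom (dvd_refl p) k))
    have hπ : ∀ a ∈ levelIn (X : (MvPolynomial ι k)[X]) H m, ∀ b ∈ levelIn (X : (MvPolynomial ι k)[X]) H m,
        proj m ((a * b : H) : (MvPolynomial ι k)[X] ≃+* (MvPolynomial ι k)[X]) i =
          proj m (a : (MvPolynomial ι k)[X] ≃+* (MvPolynomial ι k)[X]) i + proj m (b : (MvPolynomial ι k)[X] ≃+* (MvPolynomial ι k)[X]) i :=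
      fun a ha b hb => by rw [Subgroup.coe_mul]; exact proj_mul hm1 ha hb i
    have hπg : ∀ μ, proj m ((g μ : H) : (MvPolynomial ι k)[X] ≃+* (MvPolynomial ι k)[X]) i =
        ((μ : ZMod p) ^ m) • proj m (B : (MvPolynomial ι k)[X] ≃+* (MvPolynomial ι k)[X]) i := fun μ => by
      show proj m (scaleConj (castUnit p μ) (B : (MvPolynomial ι k)[X] ≃+* (MvPolynomial ι k)[X])) i =
        ((algebraMap k (MvPolynomial ι k)).comp (ZMod.castHom (dvd_refl p) k)) ((μ : ZMod p) ^ m) •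
          proj m (B : (MvPolynomial ι k)[X] ≃+* (MvPolynomial ι k)[X]) i
      rw [proj_scaleConj, val_castUnit_pow, RingHom.comp_apply, MvPolynomial.algebraMap_eq, smul_eq_mul]
    have h := (EigenProjection.character_projection p (levelIn (X : (MvPolynomial ι k)[X]) H m)
      (fun A : H => proj m (A : (MvPolynomial ι k)[X] ≃+* (MvPolynomial ι k)[X]) i) hπ g hg hπg hr hrp hm1
      (by omega : m ≤ p)).2
    rwa [if_neg (Nat.ne_of_lt hmr)] at h
  · -- the bottom character survives: character projection with `π := c(·)_z`, valued in the `𝔽_p`-module `k`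
    letI : Module (ZMod p) k := Module.compHom k (ZMod.castHom (dvd_refl p) k)
    have hπ : ∀ a ∈ (⊤ : Subgroup H), ∀ b ∈ (⊤ : Subgroup H),
        bottom r ((a * b : H) : (MvPolynomial ι k)[X] ≃+* (MvPolynomial ι k)[X]) z =
          bottom r (a : (MvPolynomial ι k)[X] ≃+* (MvPolynomial ι k)[X]) z + bottom r (b : (MvPolynomial ι k)[X] ≃+* (MvPolynomial ι k)[X]) z :=
      fun a _ b _ => by rw [Subgroup.coe_mul]; exact bottom_mul (hHZ z hz a.2) (hHZ z hz b.2)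
    have hπg : ∀ μ, bottom r ((g μ : H) : (MvPolynomial ι k)[X] ≃+* (MvPolynomial ι k)[X]) z =
        ((μ : ZMod p) ^ r) • bottom r (B : (MvPolynomial ι k)[X] ≃+* (MvPolynomial ι k)[X]) z := fun μ => by
      show bottom r (scaleConj (castUnit p μ) (B : (MvPolynomial ι k)[X] ≃+* (MvPolynomial ι k)[X])) z =
        ZMod.castHom (dvd_refl p) k ((μ : ZMod p) ^ r) • bottom r (B : (MvPolynomial ι k)[X] ≃+* (MvPolynomial ι k)[X]) z
      rw [bottom_scaleConj, val_castUnit_pow, smul_eq_mul]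
    have h := (EigenProjection.character_projection p (⊤ : Subgroup H)
      (fun A : H => bottom r (A : (MvPolynomial ι k)[X] ≃+* (MvPolynomial ι k)[X]) z) hπ g (fun _ => Subgroup.mem_top _) hπg hr hrp
      (by omega : 1 ≤ r) (by omega : r ≤ p)).2
    rwa [if_pos rfl] at h

/-- **STEP 1** (RE-DERIVATION-eng1-g43 §3.2): every `A ∈ H` (`H ≤ 𝔄_1`) is replaced by some `X₁ ∈ H ∩ 𝔄_r` with the same bottom character on every
bottom slot, by iterating the character projection through the levels `1, …, r − 1` (instrument, NOT a resolution theorem).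
[cite: Lang2002, Ch. I §3, Ch. V §5; AbramovichTemkinWlodarczyk2024, §5.1 (p. 1575)] -/
theorem exists_mem_levelIn_bottom_eq {H : Subgroup ((MvPolynomial ι k)[X] ≃+* (MvPolynomial ι k)[X])}
    (hH1 : H ≤ level (X : (MvPolynomial ι k)[X]) 1) (hHb : H ≤ baseFixing)
    (hQ : ∀ μ : (ZMod p)ˣ, ∀ A ∈ H, scaleConj (castUnit p μ) A ∈ H) {Z : Set ι} {r : ℕ} (hHZ : ∀ z ∈ Z, H ≤ pureSlot z r)
    (hr : 2 ≤ r) (hrp : r ≤ p - 1) (A : H) :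
    ∃ B : H, B ∈ levelIn (X : (MvPolynomial ι k)[X]) H r ∧
      ∀ z ∈ Z, bottom r (B : (MvPolynomial ι k)[X] ≃+* (MvPolynomial ι k)[X]) z =
        bottom r (A : (MvPolynomial ι k)[X] ≃+* (MvPolynomial ι k)[X]) z := by
  have key : ∀ m, 1 ≤ m → m ≤ r → ∃ B : H, B ∈ levelIn (X : (MvPolynomial ι k)[X]) H m ∧
      ∀ z ∈ Z, bottom r (B : (MvPolynomial ι k)[X] ≃+* (MvPolynomial ι k)[X]) z =
        bottom r (A : (MvPolynomial ι k)[X] ≃+* (MvPolynomial ι k)[X]) z := by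
    intro m hm1
    induction m, hm1 using Nat.le_induction with
    | base => exact fun _ => ⟨A, hH1 A.2, fun z _ => rfl⟩
    | succ m hm1 ih =>
      intro hmr
      obtain ⟨B, hB, hBc⟩ := ih (Nat.le_of_succ_le hmr)
      obtain ⟨B', hB', hB'c⟩ := exists_mem_levelIn_succ_bottom_eq hHb hQ hHZ hr hrp hm1 (Nat.lt_of_succ_le hmr) hB
      exact ⟨B', hB', fun z hz => (hB'c z hz).trans (hBc z hz)⟩
  exact key r (by omega) le_rfl

/-! ## The EIGEN-LIFT LEMMA -/

/-- Non-resonance turns `p ∣ (μ₀^m mod p) − n₀` into `μ₀^m = μ₀^r` (plumbing for the hypothesis `hla` of `lift_levels`). [cite: Lang2002, Ch. I §6, Ch. V §5] -/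
theorem pow_eq_pow_of_dvd {μ₀ : (ZMod p)ˣ} {n₀ r m : ℕ} (hn₀ : (n₀ : ZMod p) = (μ₀ : ZMod p) ^ r)
    (hdvd : (p : ℤ) ∣ ((((μ₀ : ZMod p) ^ m).val : ℕ) : ℤ) - (n₀ : ℤ)) : μ₀ ^ m = μ₀ ^ r := by
  haveI : NeZero p := ⟨(Fact.out : p.Prime).ne_zero⟩
  have h1 := (ZMod.intCast_eq_intCast_iff_dvd_sub (n₀ : ℤ) ((((μ₀ : ZMod p) ^ m).val : ℕ) : ℤ) p).mpr hdvd
  rw [Int.cast_natCast, Int.cast_natCast, hn₀, ZMod.natCast_zmod_val] at h1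
  exact Units.ext (by rw [Units.val_pow_eq_pow_val, Units.val_pow_eq_pow_val]; exact h1.symm)

/-- **EIGEN-LIFT LEMMA** of the toy model (RE-DERIVATION-eng1-g43 §3.2; instrument for engine 1's `W(f)` toy model, NOT a resolution theorem).
`H ≤ 𝔄_1` a `Q`-stable group of `k[σ]`-automorphisms of `k[ε][σ]` moving every bottom slot `z ∈ Z` by a pure `σ^r`-term, `2 ≤ r ≤ p − 1`, `char k = p`,
`n₀ ≡ μ₀^r (mod p)`, levels `r + 1 ≤ m < b` non-resonant (`μ₀^m ≠ μ₀^r`).  Then every `A ∈ H` has a representative `A' ∈ H` with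
(a) `c(A') = c(A)` on `Z`, (b) `A' ∈ 𝔄_r`, (c) `s_{μ₀} A' = A'^{n₀} · h` with `h ∈ H ∩ 𝔄_b`.  (`r = 2`: `b = p + 1`; `r ≥ 3`: `b = p + 2` and then
`h = 1` by `levelIn_eq_bot_of_graded`, see `eigen_lift_exact`.) [cite: Lang2002, Ch. I §§3, 6, Ch. V §5; AbramovichTemkinWlodarczyk2024, §5.1 (p. 1575)] -/
theorem eigen_lift {H : Subgroup ((MvPolynomial ι k)[X] ≃+* (MvPolynomial ι k)[X])}
    (hH1 : H ≤ level (X : (MvPolynomial ι k)[X]) 1) (hHb : H ≤ baseFixing)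
    (hQ : ∀ μ : (ZMod p)ˣ, ∀ A ∈ H, scaleConj (castUnit p μ) A ∈ H) {Z : Set ι} {r : ℕ} (hHZ : ∀ z ∈ Z, H ≤ pureSlot z r)
    (hr : 2 ≤ r) (hrp : r ≤ p - 1) (μ₀ : (ZMod p)ˣ) (n₀ : ℕ) (hn₀ : (n₀ : ZMod p) = (μ₀ : ZMod p) ^ r) {b : ℕ} (hrb : r + 1 ≤ b)
    (hres : ∀ m, r + 1 ≤ m → m < b → μ₀ ^ m ≠ μ₀ ^ r) (A : H) :
    ∃ A' : H, A' ∈ levelIn (X : (MvPolynomial ι k)[X]) H r ∧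
      (∀ z ∈ Z, bottom r (A' : (MvPolynomial ι k)[X] ≃+* (MvPolynomial ι k)[X]) z =
        bottom r (A : (MvPolynomial ι k)[X] ≃+* (MvPolynomial ι k)[X]) z) ∧
      ∃ h : H, h ∈ levelIn (X : (MvPolynomial ι k)[X]) H b ∧ sConj H hQ μ₀ A' = A' ^ n₀ * h := by
  haveI : NeZero p := ⟨(Fact.out : p.Prime).ne_zero⟩
  obtain ⟨X₁, hX₁, hX₁c⟩ := exists_mem_levelIn_bottom_eq hH1 hHb hQ hHZ hr hrp A
  have hh₁ : (X₁ ^ n₀)⁻¹ * sConj H hQ μ₀ X₁ ∈ levelIn (X : (MvPolynomial ι k)[X]) H (r + 1) :=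
    (sConj_mul_inv_pow_mem hH1 hHb hQ μ₀ r hn₀ hX₁).2
  have hx : sConj H hQ μ₀ X₁ = X₁ ^ (n₀ : ℤ) * ((X₁ ^ n₀)⁻¹ * sConj H hQ μ₀ X₁) := by
    rw [zpow_natCast, mul_inv_cancel_left]
  obtain ⟨g, hg, h', hh', hfin⟩ := EigenLiftLevels.lift_levels p (X : (MvPolynomial ι k)[X]) H hH1 (sConj H hQ μ₀) (n₀ : ℤ)
    (fun m => ((((μ₀ : ZMod p) ^ m).val : ℕ) : ℤ))
    (fun m n hn => by
      rw [zpow_natCast]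
      exact (sConj_mul_inv_pow_mem hH1 hHb hQ μ₀ m (ZMod.natCast_zmod_val _) hn).1)
    hrb (fun m hm1 hm2 hdvd => hres m hm1 hm2 (pow_eq_pow_of_dvd hn₀ hdvd)) hh₁ hx
  refine ⟨X₁ * g, ?_, fun z hz => ?_, h', hh', by rw [← zpow_natCast]; exact hfin⟩
  · exact mul_mem hX₁ (levelIn_antitone _ H (Nat.le_succ r) hg)
  · have hg' : (g : (MvPolynomial ι k)[X] ≃+* (MvPolynomial ι k)[X]) ∈ level (X : (MvPolynomial ι k)[X]) (r + 1) := hg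
    rw [Subgroup.coe_mul, bottom_mul (hHZ z hz X₁.2) (hHZ z hz g.2), bottom_eq_zero_of_mem_level r.lt_succ_self (hHZ z hz g.2) hg',
      add_zero]
    exact hX₁c z hz

/-- **(F1) termination for graded `H`**: if every element of `H` is graded with non-negative slot weights `w i < b·ρ` (`ρ ≥ 0`), then `H ∩ 𝔄_b = {1}`
(toy model: all orders `≤ p + 1`, `b = p + 2`) (bookkeeping via `LevelProjection.eq_one_of_mem_level`). [cite: Lang2002, Ch. IV §1; AbramovichTemkinWlodarczyk2024, Thm. 5.3.1 (2)–(3) (p. 1578)] -/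
theorem levelIn_eq_bot_of_graded {H : Subgroup ((MvPolynomial ι k)[X] ≃+* (MvPolynomial ι k)[X])} (hHb : H ≤ baseFixing)
    {w : ι → ℚ} {ρ : ℚ} (hHg : ∀ A ∈ H, IsGradedHom w ρ (A : (MvPolynomial ι k)[X] →+* (MvPolynomial ι k)[X]))
    (hw : ∀ i, 0 ≤ w i) (hρ : 0 ≤ ρ) {b : ℕ} (hb : ∀ i, w i < b • ρ) :
    levelIn (X : (MvPolynomial ι k)[X]) H b = ⊥ :=
  (Subgroup.eq_bot_iff_forall _).mpr fun n hn => Subtype.ext (eq_one_of_mem_level (hHg n n.2) (hHb n.2) hn hw hρ hb)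

/-- **EIGEN-LIFT LEMMA, exact form** (`H ∩ 𝔄_b = {1}`, e.g. `r ≥ 3`, `b = p + 2` for graded `H`): `s_{μ₀} A' = A'^{n₀}` exactly
(RE-DERIVATION-eng1-g43 §3.2 (c) with `h = id`; instrument, NOT a resolution theorem). [cite: Lang2002, Ch. I §§3, 6, Ch. V §5; AbramovichTemkinWlodarczyk2024, §5.1 (p. 1575)] -/
theorem eigen_lift_exact {H : Subgroup ((MvPolynomial ι k)[X] ≃+* (MvPolynomial ι k)[X])}
    (hH1 : H ≤ level (X : (MvPolynomial ι k)[X]) 1) (hHb : H ≤ baseFixing)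
    (hQ : ∀ μ : (ZMod p)ˣ, ∀ A ∈ H, scaleConj (castUnit p μ) A ∈ H) {Z : Set ι} {r : ℕ} (hHZ : ∀ z ∈ Z, H ≤ pureSlot z r)
    (hr : 2 ≤ r) (hrp : r ≤ p - 1) (μ₀ : (ZMod p)ˣ) (n₀ : ℕ) (hn₀ : (n₀ : ZMod p) = (μ₀ : ZMod p) ^ r) {b : ℕ} (hrb : r + 1 ≤ b)
    (hres : ∀ m, r + 1 ≤ m → m < b → μ₀ ^ m ≠ μ₀ ^ r) (hbot : levelIn (X : (MvPolynomial ι k)[X]) H b = ⊥) (A : H) :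
    ∃ A' : H, A' ∈ levelIn (X : (MvPolynomial ι k)[X]) H r ∧
      (∀ z ∈ Z, bottom r (A' : (MvPolynomial ι k)[X] ≃+* (MvPolynomial ι k)[X]) z =
        bottom r (A : (MvPolynomial ι k)[X] ≃+* (MvPolynomial ι k)[X]) z) ∧
      sConj H hQ μ₀ A' = A' ^ n₀ := by
  obtain ⟨A', hA', hc, h, hh, hfin⟩ := eigen_lift hH1 hHb hQ hHZ hr hrp μ₀ n₀ hn₀ hrb hres A
  rw [hbot, Subgroup.mem_bot] at hh
  exact ⟨A', hA', hc, by rw [hfin, hh, mul_one]⟩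

/-- **CLIMB in the toy model** (CARVER-NOTES-eng1-g44 §2 T108 via `EigenLiftLevels.climb_levels`; instrument for engine 1's `W(f)` toy model,
NOT a resolution theorem).  `H ≤ 𝔄_1` `Q`-stable and base-fixing, `n₀ ≡ μ₀^r (mod p)`, levels `a ≤ m < t` non-resonant (`μ₀^m ≠ μ₀^r`):
an EXACT eigen-element `Φ ∈ H` (`s_{μ₀} Φ = Φ^{n₀}`, e.g. `Φ = Φ_𝔇(σ^r)`) and an approximate one `x ∈ H` (`s_{μ₀} x = x^{n₀} h`,
`h ∈ H ∩ 𝔄_t`) with `Φ⁻¹ x ∈ H ∩ 𝔄_a` satisfy `Φ⁻¹ x ∈ H ∩ 𝔄_t`. [cite: Lang2002, Ch. I §§3, 6, Ch. V §5; AbramovichTemkinWlodarczyk2024, §5.1 (p. 1575)] -/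
theorem eigen_climb {H : Subgroup ((MvPolynomial ι k)[X] ≃+* (MvPolynomial ι k)[X])}
    (hH1 : H ≤ level (X : (MvPolynomial ι k)[X]) 1) (hHb : H ≤ baseFixing)
    (hQ : ∀ μ : (ZMod p)ˣ, ∀ A ∈ H, scaleConj (castUnit p μ) A ∈ H) (μ₀ : (ZMod p)ˣ) {r : ℕ} (n₀ : ℕ)
    (hn₀ : (n₀ : ZMod p) = (μ₀ : ZMod p) ^ r) {a t : ℕ} (hat : a ≤ t) (hres : ∀ m, a ≤ m → m < t → μ₀ ^ m ≠ μ₀ ^ r) {Φ x h : H}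
    (hE : Φ⁻¹ * x ∈ levelIn (X : (MvPolynomial ι k)[X]) H a) (hh : h ∈ levelIn (X : (MvPolynomial ι k)[X]) H t)
    (hΦ : sConj H hQ μ₀ Φ = Φ ^ n₀) (hx : sConj H hQ μ₀ x = x ^ n₀ * h) : Φ⁻¹ * x ∈ levelIn (X : (MvPolynomial ι k)[X]) H t :=
  EigenLiftLevels.climb_levels p (X : (MvPolynomial ι k)[X]) H hH1 (sConj H hQ μ₀) (n₀ : ℤ) (fun m => ((((μ₀ : ZMod p) ^ m).val : ℕ) : ℤ))
    (fun m n hn => by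
      rw [zpow_natCast]
      exact (sConj_mul_inv_pow_mem hH1 hHb hQ μ₀ m (ZMod.natCast_zmod_val _) hn).1)
    hat (fun m hm1 hm2 hdvd => hres m hm1 hm2 (pow_eq_pow_of_dvd hn₀ hdvd)) hE hh (by rw [zpow_natCast]; exact hΦ)
    (by rw [zpow_natCast]; exact hx)

/-- **CLIMB, terminal form** (`H ∩ 𝔄_t = {1}`): the approximate eigen-element IS the exact one, `x = Φ` (instrument, NOT a resolution theorem).
[cite: Lang2002, Ch. I §§3, 6, Ch. V §5; AbramovichTemkinWlodarczyk2024, §5.1 (p. 1575)] -/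
theorem eigen_climb_exact {H : Subgroup ((MvPolynomial ι k)[X] ≃+* (MvPolynomial ι k)[X])}
    (hH1 : H ≤ level (X : (MvPolynomial ι k)[X]) 1) (hHb : H ≤ baseFixing)
    (hQ : ∀ μ : (ZMod p)ˣ, ∀ A ∈ H, scaleConj (castUnit p μ) A ∈ H) (μ₀ : (ZMod p)ˣ) {r : ℕ} (n₀ : ℕ)
    (hn₀ : (n₀ : ZMod p) = (μ₀ : ZMod p) ^ r) {a t : ℕ} (hat : a ≤ t) (hres : ∀ m, a ≤ m → m < t → μ₀ ^ m ≠ μ₀ ^ r)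
    (ht : levelIn (X : (MvPolynomial ι k)[X]) H t = ⊥) {Φ x h : H}
    (hE : Φ⁻¹ * x ∈ levelIn (X : (MvPolynomial ι k)[X]) H a) (hh : h ∈ levelIn (X : (MvPolynomial ι k)[X]) H t)
    (hΦ : sConj H hQ μ₀ Φ = Φ ^ n₀) (hx : sConj H hQ μ₀ x = x ^ n₀ * h) : x = Φ := by
  have hmem := eigen_climb hH1 hHb hQ μ₀ n₀ hn₀ hat hres hE hh hΦ hx
  rw [ht, Subgroup.mem_bot, inv_mul_eq_one] at hmem
  exact hmem.symm

/-- Non-resonance from a GENERATOR: if `μ₀` has order `p − 1` in `𝔽_pˣ` then `μ₀^m ≠ μ₀^r` for `r < m < r + (p − 1)` — so `b = p + 1` works for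
`r = 2` and `b = p + 2` for `r ≥ 3` (RE-DERIVATION-eng1-g43 §3.2: "the resonant levels are `m ≡ r (mod p − 1)`"; bookkeeping). [cite: Lang2002, Ch. I §6, Ch. V §5] -/
theorem nonresonant_of_orderOf {μ₀ : (ZMod p)ˣ} (hμ₀ : orderOf μ₀ = p - 1) {r m : ℕ} (hrm : r < m) (hm : m < r + (p - 1)) :
    μ₀ ^ m ≠ μ₀ ^ r := fun h => by
  have hmod : r ≡ m [MOD p - 1] := by rw [← hμ₀]; exact (pow_eq_pow_iff_modEq.mp h).symm
  have hdvd : p - 1 ∣ m - r := (Nat.modEq_iff_dvd' hrm.le).mp hmod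
  have h0 : m - r = 0 := Nat.eq_zero_of_dvd_of_lt hdvd (by omega)
  omega

/-! ## The deepest level (T105 (n-2) / T107 of CARVER-NOTES-eng1-g43: at the deepest non-trivial level the power law is exact for EVERY `μ`) -/

/-- **The deepest non-trivial level exists**: if `H ≤ 𝔄_1` is non-trivial and `H ∩ 𝔄_b = {1}`, there is `1 ≤ r < b` with `H ∩ 𝔄_r ≠ {1}` and `H ∩ 𝔄_{r+1} = {1}`
(finite chain; bookkeeping). [cite: Lang2002, Ch. I §3] -/
theorem exists_deepest_level {H : Subgroup ((MvPolynomial ι k)[X] ≃+* (MvPolynomial ι k)[X])}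
    (hH1 : H ≤ level (X : (MvPolynomial ι k)[X]) 1) {b : ℕ} (hbot : levelIn (X : (MvPolynomial ι k)[X]) H b = ⊥)
    (hne : ∃ x : H, x ≠ 1) :
    ∃ r, 1 ≤ r ∧ r < b ∧ levelIn (X : (MvPolynomial ι k)[X]) H r ≠ ⊥ ∧ levelIn (X : (MvPolynomial ι k)[X]) H (r + 1) = ⊥ := by
  classical
  obtain ⟨x, hx⟩ := hne
  have hex : ∃ m, levelIn (X : (MvPolynomial ι k)[X]) H m = ⊥ := ⟨b, hbot⟩
  have htop : ∀ m, m ≤ 1 → levelIn (X : (MvPolynomial ι k)[X]) H m ≠ ⊥ := fun m hm h => by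
    have hxm : x ∈ levelIn (X : (MvPolynomial ι k)[X]) H m := levelIn_antitone _ H hm (hH1 x.2)
    rw [h, Subgroup.mem_bot] at hxm
    exact hx hxm
  have h2 : 2 ≤ Nat.find hex := by
    by_contra h
    exact htop _ (by omega) (Nat.find_spec hex)
  refine ⟨Nat.find hex - 1, by omega, ?_, fun h => ?_, ?_⟩
  · have := Nat.find_min' hex hbot
    omega
  · exact Nat.find_min hex (by omega : Nat.find hex - 1 < Nat.find hex) h
  · rw [Nat.sub_add_cancel (by omega : 1 ≤ Nat.find hex)]
    exact Nat.find_spec hex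

/-- **At the deepest level the power law is exact for every `μ`**: if `H ∩ 𝔄_{r+1} = {1}` then `s_μ x = x^N` for `x ∈ H ∩ 𝔄_r`, `N ≡ μ^r (mod p)`
(no eigen-lift needed there; (F3)/(F4)/(F5); instrument, NOT a resolution theorem). [cite: Lang2002, Ch. I §§3, 6, Ch. V §5; AbramovichTemkinWlodarczyk2024, §5.1 (p. 1575)] -/
theorem sConj_eq_pow_of_levelIn_succ_eq_bot {H : Subgroup ((MvPolynomial ι k)[X] ≃+* (MvPolynomial ι k)[X])}
    (hH1 : H ≤ level (X : (MvPolynomial ι k)[X]) 1) (hHb : H ≤ baseFixing)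
    (hQ : ∀ μ : (ZMod p)ˣ, ∀ A ∈ H, scaleConj (castUnit p μ) A ∈ H) {r : ℕ} (hbot : levelIn (X : (MvPolynomial ι k)[X]) H (r + 1) = ⊥)
    (μ : (ZMod p)ˣ) {N : ℕ} (hN : (N : ZMod p) = (μ : ZMod p) ^ r) {x : H} (hx : x ∈ levelIn (X : (MvPolynomial ι k)[X]) H r) :
    sConj H hQ μ x = x ^ N := by
  have h := (sConj_mul_inv_pow_mem hH1 hHb hQ μ r hN hx).1
  rw [hbot, Subgroup.mem_bot] at h
  exact mul_inv_eq_one.mp h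

/-- **`π_r` is injective on `H ∩ 𝔄_r` at the deepest level**: `H ∩ 𝔄_{r+1} = {1}`, `x ∈ H ∩ 𝔄_r`, `π_r(x) = 0 ⇒ x = 1` ((F3); bookkeeping). [cite: Lang2002, Ch. IV §1] -/
theorem eq_one_of_proj_eq_zero {H : Subgroup ((MvPolynomial ι k)[X] ≃+* (MvPolynomial ι k)[X])} (hHb : H ≤ baseFixing) {r : ℕ}
    (hbot : levelIn (X : (MvPolynomial ι k)[X]) H (r + 1) = ⊥) {x : H} (hx : x ∈ levelIn (X : (MvPolynomial ι k)[X]) H r)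
    (h0 : ∀ i, proj r (x : (MvPolynomial ι k)[X] ≃+* (MvPolynomial ι k)[X]) i = 0) : x = 1 := by
  have h : x ∈ levelIn (X : (MvPolynomial ι k)[X]) H (r + 1) := mem_level_succ_of_proj_eq_zero hx (hHb x.2) h0
  rwa [hbot, Subgroup.mem_bot] at h

/-- … and on the bottom slots the bottom character detects non-triviality: at the deepest level `r`, a non-trivial `x ∈ H ∩ 𝔄_r` all of whose NON-bottom level-`r` data vanish
has `c(x)_z ≠ 0` for some bottom slot `z` (bookkeeping; the engine's "`c_X ≠ 0`" normalisation). [cite: Lang2002, Ch. IV §1] -/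
theorem exists_bottom_ne_zero {H : Subgroup ((MvPolynomial ι k)[X] ≃+* (MvPolynomial ι k)[X])} (hHb : H ≤ baseFixing) {Z : Set ι} {r : ℕ}
    (hHZ : ∀ z ∈ Z, H ≤ pureSlot z r) (hbot : levelIn (X : (MvPolynomial ι k)[X]) H (r + 1) = ⊥) {x : H}
    (hx : x ∈ levelIn (X : (MvPolynomial ι k)[X]) H r) (hx1 : x ≠ 1)
    (hoff : ∀ i, i ∉ Z → proj r (x : (MvPolynomial ι k)[X] ≃+* (MvPolynomial ι k)[X]) i = 0) :
    ∃ z ∈ Z, bottom r (x : (MvPolynomial ι k)[X] ≃+* (MvPolynomial ι k)[X]) z ≠ 0 := by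
  by_contra hall
  push Not at hall
  refine hx1 (eq_one_of_proj_eq_zero hHb hbot hx fun i => ?_)
  by_cases hi : i ∈ Z
  · rw [proj_eq_C_bottom (hHZ i hi x.2), hall i hi, map_zero]
  · exact hoff i hi

/-! ## The engine's formulation: `H = ⟨s_μ X : μ ∈ Q⟩` -/

/-- The orbit group `⟨s_μ X₀ : μ ∈ Q⟩` is `Q`-stable (bookkeeping). [cite: Lang2002, Ch. I §3] -/
theorem scaleConj_mem_orbitClosure (X₀ : (MvPolynomial ι k)[X] ≃+* (MvPolynomial ι k)[X]) (μ : (ZMod p)ˣ)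
    {A : (MvPolynomial ι k)[X] ≃+* (MvPolynomial ι k)[X]}
    (hA : A ∈ Subgroup.closure (Set.range fun ν : (ZMod p)ˣ => scaleConj (castUnit p ν) X₀)) :
    scaleConj (castUnit p μ) A ∈ Subgroup.closure (Set.range fun ν : (ZMod p)ˣ => scaleConj (castUnit p ν) X₀) := by
  have h := Subgroup.mem_map_of_mem (scaleConj (castUnit p μ)).toMonoidHom hA
  rw [MonoidHom.map_closure] at h
  refine Subgroup.closure_mono ?_ h
  rintro _ ⟨_, ⟨ν, rfl⟩, rfl⟩
  refine ⟨μ * ν, ?_⟩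
  show scaleConj (castUnit p (μ * ν)) X₀ = scaleConj (castUnit p μ) (scaleConj (castUnit p ν) X₀)
  rw [map_mul, map_mul, MulAut.mul_apply]

/-- The orbit group inherits `𝔄_1`, `baseFixing` and the pure slots from `X₀` (bookkeeping). [cite: Lang2002, Ch. I §3] -/
theorem orbitClosure_le (X₀ : (MvPolynomial ι k)[X] ≃+* (MvPolynomial ι k)[X]) (hb : X₀ ∈ baseFixing)
    (K : Subgroup ((MvPolynomial ι k)[X] ≃+* (MvPolynomial ι k)[X])) (hK : ∀ u : kˣ, ∀ A ∈ K, A ∈ baseFixing → scaleConj u A ∈ K)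
    (hX₀ : X₀ ∈ K) : Subgroup.closure (Set.range fun ν : (ZMod p)ˣ => scaleConj (castUnit p ν) X₀) ≤ K := by
  rw [Subgroup.closure_le]
  rintro _ ⟨ν, rfl⟩
  exact hK _ X₀ hX₀ hb

/-- **EIGEN-LIFT LEMMA, the engine's formulation** (RE-DERIVATION-eng1-g43 §3.2 verbatim up to packaging): `X₀` a `k[σ]`-automorphism `≡ id (mod σ)`
moving every bottom slot `z ∈ Z` by a pure `σ^r`-term, `H := ⟨s_μ X₀ : μ ∈ 𝔽_pˣ⟩`, `2 ≤ r ≤ p − 1`, `n₀ ≡ μ₀^r`, levels `r + 1 ≤ m < b` non-resonant: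
there is `X' ∈ H` with `c(X') = c(X₀)` on `Z`, `X' ∈ 𝔄_r`, `s_{μ₀} X' = X'^{n₀} h`, `h ∈ H ∩ 𝔄_b` (instrument for engine 1's `W(f)` toy model, NOT a
resolution theorem). [cite: Lang2002, Ch. I §§3, 6, Ch. V §5; AbramovichTemkinWlodarczyk2024, §5.1 (p. 1575)] -/
theorem eigen_lift_orbit (X₀ : (MvPolynomial ι k)[X] ≃+* (MvPolynomial ι k)[X]) (hb : X₀ ∈ baseFixing)
    (h1 : X₀ ∈ level (X : (MvPolynomial ι k)[X]) 1) {Z : Set ι} {r : ℕ} (hZ : ∀ z ∈ Z, X₀ ∈ pureSlot z r)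
    (hr : 2 ≤ r) (hrp : r ≤ p - 1) (μ₀ : (ZMod p)ˣ) (n₀ : ℕ) (hn₀ : (n₀ : ZMod p) = (μ₀ : ZMod p) ^ r) {b : ℕ} (hrb : r + 1 ≤ b)
    (hres : ∀ m, r + 1 ≤ m → m < b → μ₀ ^ m ≠ μ₀ ^ r) :
    ∃ X' ∈ Subgroup.closure (Set.range fun ν : (ZMod p)ˣ => scaleConj (castUnit p ν) X₀),
      X' ∈ level (X : (MvPolynomial ι k)[X]) r ∧ (∀ z ∈ Z, bottom r X' z = bottom r X₀ z) ∧
      ∃ h ∈ Subgroup.closure (Set.range fun ν : (ZMod p)ˣ => scaleConj (castUnit p ν) X₀),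
        h ∈ level (X : (MvPolynomial ι k)[X]) b ∧ scaleConj (castUnit p μ₀) X' = X' ^ n₀ * h := by
  set H := Subgroup.closure (Set.range fun ν : (ZMod p)ˣ => scaleConj (castUnit p ν) X₀) with hH
  have hQ : ∀ μ : (ZMod p)ˣ, ∀ A ∈ H, scaleConj (castUnit p μ) A ∈ H := fun μ A hA => scaleConj_mem_orbitClosure X₀ μ hA
  have hHb : H ≤ baseFixing := orbitClosure_le X₀ hb _ (fun u A _ hA => scaleConj_mem_baseFixing u hA) hb
  have hH1 : H ≤ level (X : (MvPolynomial ι k)[X]) 1 := orbitClosure_le X₀ hb _ (fun u A hA hAb => scaleConj_mem_level u hAb hA) h1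
  have hHZ : ∀ z ∈ Z, H ≤ pureSlot z r := fun z hz => orbitClosure_le X₀ hb _ (fun u A hA _ => scaleConj_mem_pureSlot u hA) (hZ z hz)
  have hX₀ : X₀ ∈ H := by
    refine Subgroup.subset_closure ⟨1, ?_⟩
    show scaleConj (castUnit p 1) X₀ = X₀
    rw [map_one, map_one, MulAut.one_apply]
  obtain ⟨A', hA', hc, h, hh, hfin⟩ := eigen_lift hH1 hHb hQ hHZ hr hrp μ₀ n₀ hn₀ hrb hres ⟨X₀, hX₀⟩
  refine ⟨A', A'.2, hA', hc, h, h.2, hh, ?_⟩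
  have := congrArg (fun x : H => (x : (MvPolynomial ι k)[X] ≃+* (MvPolynomial ι k)[X])) hfin
  simpa only [coe_sConj, Subgroup.coe_mul, Subgroup.coe_pow] using this

/-- `𝔽_pˣ` has a generator `μ₀` of order `p − 1` (textbook; packaging of Mathlib's cyclicity of finite unit groups). [cite: Lang2002, Ch. V §5] -/
theorem exists_orderOf_eq : ∃ μ₀ : (ZMod p)ˣ, orderOf μ₀ = p - 1 := by
  obtain ⟨g, hg⟩ := IsCyclic.exists_ofOrder_eq_natCard (α := (ZMod p)ˣ)
  exact ⟨g, by rw [hg, Nat.card_eq_fintype_card, ZMod.card_units]⟩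

/-- The orbit group of a GRADED `k[σ]`-automorphism consists of graded automorphisms (bookkeeping). [cite: AbramovichTemkinWlodarczyk2024, Thm. 5.3.1 (2)–(3) (p. 1578)] -/
theorem orbitClosure_le_graded {M : Type*} [AddCommGroup M] {w : ι → M} {ρ : M} (X₀ : (MvPolynomial ι k)[X] ≃+* (MvPolynomial ι k)[X])
    (hb : X₀ ∈ baseFixing) (hg : X₀ ∈ graded w ρ) :
    Subgroup.closure (Set.range fun ν : (ZMod p)ˣ => scaleConj (castUnit p ν) X₀) ≤ graded w ρ ⊓ baseFixing := by
  refine orbitClosure_le X₀ hb _ (fun u A hA _ => ?_) ⟨hg, hb⟩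
  exact ⟨scaleConj_mem_graded u hA.2 hA.1, scaleConj_mem_baseFixing u hA.2⟩

/-- **EIGEN-LIFT LEMMA, the engine's formulation, exact form** (RE-DERIVATION-eng1-g43 §3.2 (c) for `r ≥ 3`): `X₀` a GRADED `k[σ]`-automorphism
`≡ id (mod σ)` (non-negative slot weights `w i < b·ρ`, `ρ ≥ 0` — toy model: `b = p + 2`) moving every bottom slot by a pure `σ^r`-term, `μ₀` a generator of
`𝔽_pˣ`, `2 ≤ r ≤ p − 1`, `r + 1 ≤ b ≤ r + p − 1` (so no level `r + 1 ≤ m < b` is resonant), `n₀ ≡ μ₀^r`: there is `X' ∈ H = ⟨s_μ X₀⟩` with `c(X') = c(X₀)` on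
`Z`, `X' ∈ 𝔄_r` and `s_{μ₀} X' = X'^{n₀}` EXACTLY (instrument for engine 1's `W(f)` toy model, NOT a resolution theorem).
[cite: Lang2002, Ch. I §§3, 6, Ch. V §5; AbramovichTemkinWlodarczyk2024, §5.1 (p. 1575), Thm. 5.3.1 (2)–(3) (p. 1578)] -/
theorem eigen_lift_orbit_exact {w : ι → ℚ} {ρ : ℚ} (X₀ : (MvPolynomial ι k)[X] ≃+* (MvPolynomial ι k)[X]) (hg : X₀ ∈ graded w ρ)
    (hb : X₀ ∈ baseFixing) (h1 : X₀ ∈ level (X : (MvPolynomial ι k)[X]) 1) {Z : Set ι} {r : ℕ} (hZ : ∀ z ∈ Z, X₀ ∈ pureSlot z r)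
    (hr : 2 ≤ r) (hrp : r ≤ p - 1) (hw : ∀ i, 0 ≤ w i) (hρ : 0 ≤ ρ) {b : ℕ} (hrb : r + 1 ≤ b) (hbp : b ≤ r + (p - 1))
    (hwb : ∀ i, w i < b • ρ) {μ₀ : (ZMod p)ˣ} (hμ₀ : orderOf μ₀ = p - 1) (n₀ : ℕ) (hn₀ : (n₀ : ZMod p) = (μ₀ : ZMod p) ^ r) :
    ∃ X' ∈ Subgroup.closure (Set.range fun ν : (ZMod p)ˣ => scaleConj (castUnit p ν) X₀),
      X' ∈ level (X : (MvPolynomial ι k)[X]) r ∧ (∀ z ∈ Z, bottom r X' z = bottom r X₀ z) ∧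
      scaleConj (castUnit p μ₀) X' = X' ^ n₀ := by
  obtain ⟨X', hX'H, hX'r, hc, h, hhH, hhb, hfin⟩ := eigen_lift_orbit X₀ hb h1 hZ hr hrp μ₀ n₀ hn₀ hrb
    (fun m hm1 hm2 => nonresonant_of_orderOf hμ₀ (by omega) (by omega))
  have hHg := orbitClosure_le_graded (p := p) X₀ hb hg
  have h1' : h = 1 := eq_one_of_mem_level (hHg hhH).1.1 (hHg hhH).2 hhb hw hρ hwb
  exact ⟨X', hX'H, hX'r, hc, by rw [hfin, h1', mul_one]⟩

end Literature.AlgebraicGeometry.Resolution.WeightedBlowup.EigenLift
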